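import Literature.NumberTheory.DiophantineGeometry.MultiplicativeGroupApproximationReductionProofs
import Literature.Barriers.ABC.BakerMethodBoundsYuInputProofs
import HarnessLib

/-!
# The `p`-adic approximation bound over `ℚ` from a core in SHAPE form — preparatory lemmas:
# passage to `p`-adic units, squaring away the torsion, and the Case-A bookkeeping at `α = 1`

Topic `NumberTheory/DiophantineGeometry`; namespace `Literature.NumberTheory.DiophantineGeometry.Dioph`.
Proofs only: no definition, no named fact. First of three companion files
(`…PadicUnitsProofs`, `…PadicCaseAProofs`, `…PadicOfCoreProofs`) deriving
`padicApproximationBound_rat` (Pasten 2024 Thm 2.1 (ii), `d = 1`, constant existential) from a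
`p`-adic linear-forms bound in shape form, along Evertse–Győry's proof of their Thm 4.2.1
(§4.4.2, pp. 80–81) at `K = ℚ`, `α = 1`. This file holds the place-light lemmas:

* `exists_padicUnit_system` — Yu's passage to `p`-adic units `θᵢ = ξᵢ p^{−ord_p ξᵢ}`
  (`h(θᵢ) ≤ h(ξᵢ)`, same product when `ord_p ∏ ξᵢ^{bᵢ} = 0`);
* `sq_system_on_subtype` — on `{i // θᵢ² ≠ 1}` the squares are `p`-adic units `∉ {0, ±1}`,
  `≡ 1 (mod 8)` at `p = 2`, with product `(∏ θᵢ^{bᵢ})²` (signs and new torsion disappear);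
* `caseA_logslot_le` — the logarithm of Case A at `α = 1`:
  `(m+1) log B₀ + log p + m log(3B₀) + 2m ≤ 16^m log max(e, p h(x))` for `B₀ = m^{2m} h(x)/log 2`
  (this is where NO `δ/Bₙ` refinement is needed at `α = 1`);
* `logHeight₁_mul_pow_le_prod`, `two_mul_logHeight₁_le_of_caseA` — in Case A every `2h(ξ'ᵢ) ≤ B₀`.

## References

* [EvertseGyory2015] J.-H. Evertse, K. Győry, *Unit Equations in Diophantine Number Theory*,
  CUP 2015 — proof of Thm 4.2.1, §4.4.2 (pp. 80–81); Prop 3.2.9 (p. 62).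
* [Yu1999] K. Yu, *p-adic logarithmic forms and group varieties II*, Acta Arith. 89 (1999) —
  §1 (p. 339): passage to `p`-adic units.
-/

noncomputable section

open Finset Real Height

namespace Literature.NumberTheory.DiophantineGeometry.Dioph

/-! ### Elementary valuation lemmas -/

/-- `ord_p (x / p^{ord_p x}) = 0` for `x ≠ 0`. [folklore] -/
private theorem padicValRat_div_zpow_self {p : ℕ} [hp : Fact p.Prime] {x : ℚ} (hx : x ≠ 0) :
    padicValRat p (x / (p : ℚ) ^ padicValRat p x) = 0 := by
  have hp0 : (p : ℚ) ≠ 0 := by exact_mod_cast hp.out.ne_zero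
  rw [padicValRat.div hx (zpow_ne_zero _ hp0), padicValRat.zpow, padicValRat.self hp.out.one_lt]
  ring

/-- For a rational `2`-adic unit `u` with `u² ≠ 1`: `ord₂(u² − 1) ≥ 3` (odd squares are `1 mod 8`,
`Int.eight_dvd_sq_sub_one_of_odd`). [folklore] -/
private theorem three_le_padicValRat_two_sq_sub_one {u : ℚ} (hu : u ≠ 0) (hv : padicValRat 2 u = 0)
    (h1 : u ^ 2 - 1 ≠ 0) : 3 ≤ padicValRat 2 (u ^ 2 - 1) := by
  haveI : Fact (Nat.Prime 2) := ⟨Nat.prime_two⟩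
  have hnum : u.num ≠ 0 := Rat.num_ne_zero.mpr hu
  have hv' := hv
  rw [padicValRat_def] at hv'
  have hden : ¬ 2 ∣ u.den := by
    intro hden
    have h1 : padicValNat 2 u.den ≠ 0 := by
      rw [Ne, padicValNat.eq_zero_iff]; push Not
      exact ⟨by norm_num, u.den_ne_zero, hden⟩
    have h2 : padicValInt 2 u.num ≠ 0 := by omega
    have h3 : (2 : ℤ) ∣ u.num := by
      by_contra h; exact h2 (padicValInt.eq_zero_of_not_dvd h)
    have h4 : 2 ∣ u.num.natAbs := Int.natAbs_dvd_natAbs.mpr h3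
    have h5 : 2 ∣ Nat.gcd u.num.natAbs u.den := Nat.dvd_gcd h4 hden
    rw [Nat.Coprime.gcd_eq_one u.reduced] at h5
    exact absurd (Nat.le_of_dvd one_pos h5) (by norm_num)
  have hnum2 : ¬ (2 : ℤ) ∣ u.num := by
    have h1 : padicValNat 2 u.den = 0 := padicValNat.eq_zero_of_not_dvd hden
    have h2 : padicValInt 2 u.num = 0 := by omega
    intro h
    rw [padicValInt.eq_zero_iff] at h2
    rcases h2 with h2 | h2 | h2
    · norm_num at h2
    · exact hnum h2
    · exact h2 (by exact_mod_cast h)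
  have hnumodd : Odd u.num := by rwa [← Int.not_even_iff_odd, even_iff_two_dvd]
  have hdenodd : Odd (u.den : ℤ) := by
    rw [← Int.not_even_iff_odd, even_iff_two_dvd]; exact_mod_cast hden
  have h8' : (8 : ℤ) ∣ u.num ^ 2 - (u.den : ℤ) ^ 2 := by
    have e : u.num ^ 2 - (u.den : ℤ) ^ 2 = (u.num ^ 2 - 1) - ((u.den : ℤ) ^ 2 - 1) := by ring
    exact e ▸ dvd_sub (Int.eight_dvd_sq_sub_one_of_odd hnumodd) (Int.eight_dvd_sq_sub_one_of_odd hdenodd)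
  have hden' : (u.den : ℚ) ≠ 0 := by exact_mod_cast u.den_ne_zero
  have hrepr : u ^ 2 - 1 = ((u.num ^ 2 - (u.den : ℤ) ^ 2 : ℤ) : ℚ) / (u.den : ℚ) ^ 2 := by
    push_cast
    rw [show (u.num : ℚ) = u * u.den from (Rat.mul_den_eq_num u).symm]
    field_simp
  have hN : (u.num ^ 2 - (u.den : ℤ) ^ 2 : ℤ) ≠ 0 := by
    intro h0; apply h1; rw [hrepr, h0]; simp
  rw [hrepr, padicValRat.div (by exact_mod_cast hN) (pow_ne_zero 2 hden'), padicValRat.pow,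
    padicValRat.of_int, padicValRat.of_nat, padicValNat.eq_zero_of_not_dvd hden]
  have h3 : 3 ≤ padicValInt 2 (u.num ^ 2 - (u.den : ℤ) ^ 2) := by
    have h8'' : ((2 : ℕ) : ℤ) ^ 3 ∣ u.num ^ 2 - (u.den : ℤ) ^ 2 := by norm_num; exact h8'
    rcases (padicValInt_dvd_iff 3 _).mp h8'' with h | h
    · exact absurd h hN
    · exact h
  push_cast
  have : (3 : ℤ) ≤ padicValInt 2 (u.num ^ 2 - (u.den : ℤ) ^ 2) := by exact_mod_cast h3
  linarith


/-! ### Passage to `p`-adic units and removal of the torsion they create -/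

/-- **Passage to `p`-adic units** (Yu 1999, §1): if `ord_p(∏ ξᵢ^{bᵢ}) = 0`, then with
`θᵢ := ξᵢ · p^{−ord_p ξᵢ}` one has `ord_p θᵢ = 0`, `h(θᵢ) ≤ h(ξᵢ)` and `∏ θᵢ^{bᵢ} = ∏ ξᵢ^{bᵢ}`.
[cite: Yu1999, §1 (p. 339)] -/
theorem exists_padicUnit_system {p : ℕ} [hp : Fact p.Prime] {ι : Type} [Fintype ι] [DecidableEq ι]
    (ξ : ι → ℚ) (hξ0 : ∀ i, ξ i ≠ 0) (b : ι → ℤ) (hv : padicValRat p (∏ i, ξ i ^ b i) = 0) :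
    ∃ θ : ι → ℚ, (∀ i, θ i ≠ 0) ∧ (∀ i, padicValRat p (θ i) = 0) ∧
      (∀ i, logHeight₁ (θ i) ≤ logHeight₁ (ξ i)) ∧ ∏ i, θ i ^ b i = ∏ i, ξ i ^ b i := by
  have hp0 : (p : ℚ) ≠ 0 := by exact_mod_cast hp.out.ne_zero
  refine ⟨fun i => ξ i / (p : ℚ) ^ padicValRat p (ξ i), fun i => ?_,
    fun i => padicValRat_div_zpow_self (hξ0 i),
    fun i => Literature.Barriers.ABC.logHeight₁_div_zpow_padicValRat_le hp.out (hξ0 i), ?_⟩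
  · exact div_ne_zero (hξ0 i) (zpow_ne_zero _ hp0)
  · have hsum : ∑ i, -(padicValRat p (ξ i) * b i) = 0 := by
      rw [Literature.Barriers.ABC.padicValRat_finset_prod _ _ (fun i _ => zpow_ne_zero _ (hξ0 i))]
        at hv
      rw [Finset.sum_neg_distrib, neg_eq_zero, ← hv]
      refine Finset.sum_congr rfl fun i _ => ?_
      rw [padicValRat.zpow, mul_comm]
    have h1 : ∀ i, (ξ i / (p : ℚ) ^ padicValRat p (ξ i)) ^ b i =
        ξ i ^ b i * (p : ℚ) ^ (-(padicValRat p (ξ i) * b i)) := fun i => by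
      rw [div_zpow, ← zpow_mul, div_eq_mul_inv, ← zpow_neg]
    simp_rw [h1]
    rw [Finset.prod_mul_distrib, Literature.Barriers.ABC.rat_prod_zpow_eq_zpow_sum _ hp0, hsum,
      zpow_zero, mul_one]

/-- **Squaring away the torsion.** For `p`-adic units `θᵢ ≠ 0` with `∏ θᵢ^{bᵢ} = y`, on the
subtype `κ = {i // θᵢ² ≠ 1}` the squares `ηₖ = θₖ²` are `p`-adic units `∉ {0, 1, −1}`, congruent
to `1 mod 8` when `p = 2`, with `h(ηₖ) = 2 h(θₖ)` and `∏_κ ηₖ^{bₖ} = y²` (the `θᵢ = ±1` drop out).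
[cite: EvertseGyory2015, §4.4.2 (p. 81)] -/
theorem sq_system_on_subtype {p : ℕ} [hp : Fact p.Prime] {ι : Type} [Fintype ι] [DecidableEq ι]
    (θ : ι → ℚ) (hθ0 : ∀ i, θ i ≠ 0) (hθv : ∀ i, padicValRat p (θ i) = 0) (b : ι → ℤ) :
    (∀ k : {i // θ i ^ 2 ≠ 1}, θ k.val ^ 2 ≠ 0 ∧ padicValRat p (θ k.val ^ 2) = 0 ∧
        θ k.val ^ 2 ≠ 1 ∧ θ k.val ^ 2 ≠ -1 ∧ (p = 2 → 3 ≤ padicValRat 2 (θ k.val ^ 2 - 1)) ∧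
        logHeight₁ (θ k.val ^ 2) = 2 * logHeight₁ (θ k.val)) ∧
      ∏ k : {i // θ i ^ 2 ≠ 1}, (θ k.val ^ 2) ^ b k.val = (∏ i, θ i ^ b i) ^ 2 := by
  refine ⟨fun k => ⟨pow_ne_zero 2 (hθ0 k.val), by rw [padicValRat.pow, hθv]; simp, k.prop, ?_, ?_, ?_⟩,
    ?_⟩
  · have h : (0 : ℚ) ≤ θ k.val ^ 2 := sq_nonneg _
    intro h1; rw [h1] at h; norm_num at h
  · intro hp2
    have hv2 : padicValRat 2 (θ k.val) = 0 := by have h := hθv k.val; rwa [hp2] at h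
    exact three_le_padicValRat_two_sq_sub_one (hθ0 k.val) hv2 (sub_ne_zero.mpr k.prop)
  · rw [logHeight₁_pow]; push_cast; ring
  · -- the product over the subtype is the product over `ι` of `(θᵢ²)^{bᵢ}` (the others are `1`)
    have h1 : ∏ k : {i // θ i ^ 2 ≠ 1}, (θ k.val ^ 2) ^ b k.val =
        ∏ i ∈ univ.filter (fun i => θ i ^ 2 ≠ 1), (θ i ^ 2) ^ b i :=
      (Finset.prod_subtype (univ.filter fun i => θ i ^ 2 ≠ 1) (fun i => by simp)
        (fun i => (θ i ^ 2) ^ b i)).symm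
    rw [h1, Finset.prod_filter_of_ne (fun i _ hne => ?_)]
    · rw [← Finset.prod_pow]
      refine Finset.prod_congr rfl fun i _ => ?_
      rw [← zpow_natCast, ← zpow_natCast, ← zpow_mul, ← zpow_mul, mul_comm]
    · intro h; apply hne; rw [h, one_zpow]

/-! ### Real-analytic bookkeeping for Case A -/

/-- `4m³ + 4m + 2 ≤ 16^m` for `m ≥ 1`. [folklore] -/
private theorem poly_le_sixteen_pow (m : ℕ) (hm : 1 ≤ m) : (4 * (m : ℝ) ^ 3 + 4 * m + 2) ≤ 16 ^ m := by
  have key : ∀ n : ℕ, 4 * (n + 1) ^ 3 + 4 * (n + 1) + 2 ≤ 16 ^ (n + 1) := by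
    intro n
    induction n with
    | zero => norm_num
    | succ n ih =>
      have h16 : 16 ^ (n + 1 + 1) = 16 * 16 ^ (n + 1) := by ring
      rw [h16]
      nlinarith [ih, sq_nonneg (n : ℕ)]
  obtain ⟨n, rfl⟩ : ∃ n, m = n + 1 := ⟨m - 1, by omega⟩
  have := key n
  exact_mod_cast this

/-- **The logarithm of Case A at `α = 1` is `≤ 16^m · log max(e, p·h(x))`**: with
`B₀ = m^{2m} h(x)/log 2 ≥ 3`,
`(m+1) log B₀ + log p + m log(3B₀) + 2m ≤ 16^m log max(e, p h(x))` (uses `log m ≤ m − 1`,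
`log log 2 ≥ −1/2`, `log 3 ≤ 2`, `4m³ + 4m + 2 ≤ 16^m`). [cite: EvertseGyory2015, §4.4.2 (p. 81)] -/
theorem caseA_logslot_le (m : ℕ) (hm : 1 ≤ m) {hx p B₀ : ℝ} (hhx : 0 < hx) (hp : 1 ≤ p)
    (hB₀ : B₀ = (m : ℝ) ^ (2 * m) * hx / Real.log 2) (hB3 : 3 ≤ B₀) :
    ((m : ℝ) + 1) * Real.log B₀ + Real.log p + m * Real.log (3 * B₀) + 2 * m ≤
      16 ^ m * Real.log (max (Real.exp 1) (p * hx)) := by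
  set L := Real.log (max (Real.exp 1) (p * hx)) with hL
  have hm0 : (0 : ℝ) < m := by exact_mod_cast hm
  have hm1 : (1 : ℝ) ≤ m := by exact_mod_cast hm
  have hl2 : 0 < Real.log 2 := Real.log_pos one_lt_two
  have hp0 : 0 < p := by linarith
  have hL1 : 1 ≤ L := by
    rw [hL, ← Real.log_exp 1]
    exact Real.log_le_log (Real.exp_pos 1) (by rw [Real.log_exp]; exact le_max_left _ _)
  have hLsum : Real.log p + Real.log hx ≤ L := by
    rw [← Real.log_mul hp0.ne' hhx.ne', hL]
    exact Real.log_le_log (mul_pos hp0 hhx) (le_max_right _ _)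
  have hlogp : 0 ≤ Real.log p := Real.log_nonneg hp
  have hmpow : 0 < (m : ℝ) ^ (2 * m) := pow_pos hm0 _
  have hlogB : Real.log B₀ = 2 * m * Real.log m + Real.log hx - Real.log (Real.log 2) := by
    rw [hB₀, Real.log_div (mul_pos hmpow hhx).ne' hl2.ne', Real.log_mul hmpow.ne' hhx.ne',
      Real.log_pow]
    push_cast; ring
  have hloglog : -(1 / 2 : ℝ) ≤ Real.log (Real.log 2) := by
    have h := Real.log_le_log (Real.exp_pos _) Literature.Barriers.ABC.exp_neg_half_le_log_two
    rw [Real.log_exp] at h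
    linarith
  have hlogm : Real.log m ≤ m - 1 := Real.log_le_sub_one_of_pos hm0
  have hlog3 : Real.log 3 ≤ 2 := by
    have := Real.log_le_sub_one_of_pos (show (0 : ℝ) < 3 by norm_num); linarith
  have hB0 : 0 < B₀ := by linarith
  have hlog3B : Real.log (3 * B₀) = Real.log 3 + Real.log B₀ := Real.log_mul (by norm_num) hB0.ne'
  -- the `log hx` terms against `L`
  have h2m0 : (0 : ℝ) ≤ 2 * m := by positivity
  have h2m1 : (0 : ℝ) ≤ 2 * m + 1 := by positivity
  have hkey : (2 * (m : ℝ) + 1) * Real.log hx + Real.log p ≤ (2 * m + 1) * L := by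
    have hk1 : (2 * (m : ℝ) + 1) * (Real.log p + Real.log hx) ≤ (2 * m + 1) * L :=
      mul_le_mul_of_nonneg_left hLsum h2m1
    rcases le_or_gt 0 (Real.log hx) with h | h
    · have hk2 : 0 ≤ 2 * (m : ℝ) * Real.log p := mul_nonneg h2m0 hlogp
      nlinarith [hk1, hk2]
    · have hk2 : 2 * (m : ℝ) * Real.log hx ≤ 0 := mul_nonpos_of_nonneg_of_nonpos h2m0 h.le
      have hk3 : 0 ≤ 2 * (m : ℝ) * L := mul_nonneg h2m0 (by linarith)
      nlinarith [hk2, hk3, hLsum]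
  -- `log B₀ ≤ 2 m (m - 1) + log hx + 1/2`
  have hlogB' : Real.log B₀ ≤ 2 * m * (m - 1) + Real.log hx + 1 / 2 := by
    rw [hlogB]
    have : 2 * (m : ℝ) * Real.log m ≤ 2 * m * (m - 1) := mul_le_mul_of_nonneg_left hlogm h2m0
    linarith
  have hpoly := poly_le_sixteen_pow m hm
  -- assemble
  have h1 : ((m : ℝ) + 1) * Real.log B₀ + Real.log p + m * Real.log (3 * B₀) + 2 * m =
      (2 * m + 1) * Real.log B₀ + Real.log p + m * Real.log 3 + 2 * m := by rw [hlog3B]; ring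
  rw [h1]
  have h2 : (2 * (m : ℝ) + 1) * Real.log B₀ ≤
      (2 * m + 1) * (2 * m * (m - 1) + 1 / 2) + (2 * m + 1) * Real.log hx := by
    have := mul_le_mul_of_nonneg_left hlogB' h2m1
    linarith
  have h3 : (m : ℝ) * Real.log 3 ≤ 2 * m := by
    have := mul_le_mul_of_nonneg_left hlog3 hm0.le
    linarith
  have h4 : (2 * (m : ℝ) + 1) * (2 * m * (m - 1) + 1 / 2) + 2 * m + 2 * m + (2 * m + 1) ≤
      4 * (m : ℝ) ^ 3 + 4 * m + 2 := by nlinarith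
  have h5 : (4 * (m : ℝ) ^ 3 + 4 * m + 2) * L ≤ 16 ^ m * L :=
    mul_le_mul_of_nonneg_right hpoly (by linarith)
  set A := (2 * (m : ℝ) + 1) * (2 * m * (m - 1) + 1 / 2) + 4 * m with hA
  have hA0 : 0 ≤ A := by
    have : (0 : ℝ) ≤ m - 1 := by linarith
    positivity
  have hAL : A ≤ A * L := le_mul_of_one_le_right hA0 hL1
  have h6 : (A + (2 * m + 1)) * L ≤ (4 * (m : ℝ) ^ 3 + 4 * m + 2) * L :=
    mul_le_mul_of_nonneg_right (by linarith) (by linarith)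
  have h7 : (A + (2 * (m : ℝ) + 1)) * L = A * L + (2 * m + 1) * L := by ring
  rw [h7] at h6
  linarith

/-- For non-torsion `ξ'ᵢ` (`h(ξ'ᵢ) ≥ log 2`): `h(ξ'ᵢ) · (log 2)^{m−1} ≤ Θ' = ∏ⱼ h(ξ'ⱼ)`.
[cite: EvertseGyory2015, Prop 3.2.9 (p. 62)] -/
theorem logHeight₁_mul_pow_le_prod {ι : Type} [Fintype ι] [DecidableEq ι] {n : ℕ}
    (hcard : Fintype.card ι = n + 1) (ξ : ι → ℚ) (hξ : ∀ i, ξ i ≠ 0 ∧ ξ i ≠ 1 ∧ ξ i ≠ -1)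
    (i : ι) : logHeight₁ (ξ i) * Real.log 2 ^ n ≤ ∏ j, logHeight₁ (ξ j) := by
  rw [← Finset.mul_prod_erase univ (fun j => logHeight₁ (ξ j)) (mem_univ i)]
  have hcard' : (univ.erase i).card = n := by
    rw [Finset.card_erase_of_mem (mem_univ i), card_univ, hcard]; simp
  have h1 : Real.log 2 ^ n = ∏ _j ∈ univ.erase i, Real.log 2 := by
    rw [Finset.prod_const, hcard']
  rw [h1]
  apply mul_le_mul_of_nonneg_left _ (zero_le_logHeight₁ _)
  exact Finset.prod_le_prod (fun _ _ => (Real.log_pos one_lt_two).le)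
    fun j _ => log_two_le_logHeight₁ (hξ j).1 (hξ j).2.1 (hξ j).2.2

/-- In Case A (`2e · 9^{m+1} · Θ' ≤ B₀`) every height of the small system is small against `B₀`:
`2 h(ξ'ᵢ) ≤ B₀`. [cite: EvertseGyory2015, §4.4.2 (p. 81)] -/
theorem two_mul_logHeight₁_le_of_caseA {ι : Type} [Fintype ι] [DecidableEq ι] {n : ℕ}
    (hcard : Fintype.card ι = n + 1) (ξ : ι → ℚ) (hξ : ∀ i, ξ i ≠ 0 ∧ ξ i ≠ 1 ∧ ξ i ≠ -1)
    {B₀ : ℝ} (hcase : 2 * Real.exp 1 * 9 ^ (n + 1 + 1) * (∏ j, logHeight₁ (ξ j)) ≤ B₀) (i : ι) :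
    2 * logHeight₁ (ξ i) ≤ B₀ := by
  have h1 := logHeight₁_mul_pow_le_prod hcard ξ hξ i
  have hh0 : 0 ≤ logHeight₁ (ξ i) := zero_le_logHeight₁ _
  have hl2 : (1 / 2 : ℝ) ≤ Real.log 2 := by linarith [Real.log_two_gt_d9]
  have he1 : (1 : ℝ) ≤ Real.exp 1 := Real.one_le_exp zero_le_one
  -- `1 ≤ e · 9^{n+2} · (log 2)^n`
  have hpow : (1 : ℝ) ≤ 9 ^ (n + 1 + 1) * Real.log 2 ^ n := by
    have h2 : (1 / 2 : ℝ) ^ n ≤ Real.log 2 ^ n := pow_le_pow_left₀ (by norm_num) hl2 n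
    have h3 : (1 : ℝ) ≤ 9 ^ (n + 1 + 1) * (1 / 2) ^ n := by
      rw [pow_succ, pow_succ, show (9 : ℝ) ^ n * 9 * 9 * (1 / 2) ^ n = 81 * (9 * (1 / 2)) ^ n by
        rw [mul_pow]; ring]
      have : (1 : ℝ) ≤ (9 * (1 / 2)) ^ n := one_le_pow₀ (by norm_num)
      nlinarith
    have h4 : (0 : ℝ) ≤ 9 ^ (n + 1 + 1) := by positivity
    nlinarith
  have hfac : (1 : ℝ) ≤ Real.exp 1 * (9 ^ (n + 1 + 1) * Real.log 2 ^ n) := by nlinarith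
  calc 2 * logHeight₁ (ξ i) = 2 * logHeight₁ (ξ i) * 1 := by ring
    _ ≤ 2 * logHeight₁ (ξ i) * (Real.exp 1 * (9 ^ (n + 1 + 1) * Real.log 2 ^ n)) :=
        mul_le_mul_of_nonneg_left hfac (by positivity)
    _ = 2 * Real.exp 1 * 9 ^ (n + 1 + 1) * (logHeight₁ (ξ i) * Real.log 2 ^ n) := by ring
    _ ≤ 2 * Real.exp 1 * 9 ^ (n + 1 + 1) * ∏ j, logHeight₁ (ξ j) :=
        mul_le_mul_of_nonneg_left h1 (by positivity)
    _ ≤ B₀ := hcase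


end Literature.NumberTheory.DiophantineGeometry.Dioph

end
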